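import Summits.QuantumAdvantage.AdviceFreeQNC0.AffBells21Characters
import HarnessLib

/-!
# Cell qa-qnc0, frame averaging (ROUND-21 §4.7): coordinate products of signs versus an `𝔽₃`-character

Support for crux `RingDenseResidualLt3` (stmt-QuantumAdvantage-22907), route `DWalkThree`; planner qa-qnc0-p1 g22 ask P-22g
(the `w₀ ≤ 1` error lemma of frame averaging, generalised).  Generic tools, no cell objects:
* `sgnB` (`(−1)^{[b]}`), `sgnB_xor`, `neg_one_pow_card_filter_eq_prod_sgnB`;
* `IsCoordProduct Ψ` — `Ψ(v) = c · Π_i h_i(v_i)` with `c, h_i(b) ∈ {±1}` — closed under products (`IsCoordProduct.mul`,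
  `isCoordProduct_prod`), containing constants and single-coordinate sign functions (`isCoordProduct_single`);
* **`norm_sum_coordProduct_mul_char_le`**: `‖Σ_{v ∈ {0,1}^ι} Ψ(v) ω^{Σ_i [v_i]γ_i}‖ ≤ Π_i (γ_i ≠ 0 ? √3 : 2)` — one coordinate
  at a time, `‖1 ± ω^γ‖ ≤ 2cos(π/6) = √3` for `γ ≠ 0` (`TwoModuli.norm_one_add_stdAddChar_mul_stdAddChar_le`, coprime moduli
  `3, 2`), the mechanism of `TwoModuli.charVsProduct` for ARBITRARY `±1`-valued coordinate factors.

WHAT THIS IS NOT: no cell statement; consumed by the fibrewise twist bound of frozen `1`-junta strategies.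
-/

namespace Summit.QuantumAdvantage.AdviceFreeQNC0

open Finset
open Literature.Computability.MetaComplexity

namespace AffBells22

/-! ## Signs -/

/-- The sign `(−1)^{[b]}` of a Boolean. -/
noncomputable def sgnB (b : Bool) : ℂ := if b then -1 else 1

/-- `sgnB` is `±1`. -/
theorem sgnB_cases (b : Bool) : sgnB b = 1 ∨ sgnB b = -1 := by
  cases b <;> simp [sgnB]

/-- `sgnB (a ⊕ b) = sgnB a · sgnB b`. -/
theorem sgnB_xor (a b : Bool) : sgnB (xor a b) = sgnB a * sgnB b := by
  cases a <;> cases b <;> simp [sgnB]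

/-- `(−1)^{#{k : p k}} = Π_k sgnB [p k]` on a finset. -/
theorem neg_one_pow_card_filter_eq_prod_sgnB {κ : Type*} (s : Finset κ) (p : κ → Bool) :
    (-1 : ℂ) ^ (s.filter fun k => p k = true).card = ∏ k ∈ s, sgnB (p k) := by
  show _ = ∏ k ∈ s, (if p k = true then (-1 : ℂ) else 1)
  rw [prod_ite, prod_const_one, mul_one, prod_const]

/-! ## Coordinate products -/

variable {ι : Type*} [Fintype ι] [DecidableEq ι]

/-- `Ψ` is a signed product of `±1`-valued functions of single coordinates. -/
def IsCoordProduct (Ψ : (ι → Bool) → ℂ) : Prop :=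
  ∃ c : ℂ, (c = 1 ∨ c = -1) ∧ ∃ h : ι → Bool → ℂ, (∀ i b, h i b = 1 ∨ h i b = -1) ∧ ∀ v, Ψ v = c * ∏ i, h i (v i)

omit [DecidableEq ι] in
/-- A constant `±1` is a coordinate product. -/
theorem isCoordProduct_const {c : ℂ} (hc : c = 1 ∨ c = -1) : IsCoordProduct (fun _ : ι → Bool => c) :=
  ⟨c, hc, fun _ _ => 1, fun _ _ => Or.inl rfl, fun v => by simp⟩

/-- A `±1`-valued function of one coordinate is a coordinate product. -/
theorem isCoordProduct_single (i₀ : ι) (H : Bool → ℂ) (hH : ∀ b, H b = 1 ∨ H b = -1) :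
    IsCoordProduct (fun v : ι → Bool => H (v i₀)) := by
  refine ⟨1, Or.inl rfl, fun i b => if i = i₀ then H b else 1, ?_, fun v => ?_⟩
  · intro i b
    by_cases hi : i = i₀
    · simp only [hi, if_true]; exact hH b
    · simp [hi]
  · show H (v i₀) = 1 * ∏ i, (if i = i₀ then H (v i) else 1)
    rw [one_mul, ← Finset.prod_erase_mul _ _ (mem_univ i₀), if_pos rfl,
      Finset.prod_eq_one (fun i hi => by rw [if_neg (ne_of_mem_erase hi)]), one_mul]

omit [DecidableEq ι] in
/-- Coordinate products are closed under multiplication. -/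
theorem IsCoordProduct.mul {Ψ₁ Ψ₂ : (ι → Bool) → ℂ} (h₁ : IsCoordProduct Ψ₁) (h₂ : IsCoordProduct Ψ₂) :
    IsCoordProduct (fun v => Ψ₁ v * Ψ₂ v) := by
  obtain ⟨c₁, hc₁, g₁, hg₁, e₁⟩ := h₁
  obtain ⟨c₂, hc₂, g₂, hg₂, e₂⟩ := h₂
  refine ⟨c₁ * c₂, ?_, fun i b => g₁ i b * g₂ i b, ?_, fun v => ?_⟩
  · rcases hc₁ with h | h <;> rcases hc₂ with h' | h' <;> simp [h, h']
  · intro i b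
    rcases hg₁ i b with h | h <;> rcases hg₂ i b with h' | h' <;> simp [h, h']
  · show Ψ₁ v * Ψ₂ v = _
    rw [e₁ v, e₂ v, prod_mul_distrib]; ring

omit [DecidableEq ι] in
/-- Coordinate products are closed under finite products. -/
theorem isCoordProduct_prod {κ : Type*} (s : Finset κ) (Ψ : κ → (ι → Bool) → ℂ)
    (h : ∀ k ∈ s, IsCoordProduct (Ψ k)) : IsCoordProduct (fun v => ∏ k ∈ s, Ψ k v) := by
  classical
  induction s using Finset.induction_on with
  | empty => simpa using isCoordProduct_const (ι := ι) (Or.inl rfl)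
  | insert k s hk ih =>
    have hk' := h k (mem_insert_self k s)
    have hs := ih (fun k' hk' => h k' (mem_insert_of_mem hk'))
    have := hk'.mul hs
    simpa [prod_insert hk] using this

/-! ## The product-times-character bound -/

/-- `χ₂(1) = −1` for the standard additive character of `ℤ/2`. -/
theorem stdAddChar_one_zmod_two : (ZMod.stdAddChar (1 : ZMod 2) : ℂ) = -1 := by
  rw [show (1 : ZMod 2) = ((1 : ℕ) : ZMod 2) from rfl, ZMod.stdAddChar_apply, ZMod.toCircle_natCast,
    ← Complex.exp_pi_mul_I]
  congr 1
  push_cast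
  ring

/-- One coordinate: `‖g₀ + g₁·ω^γ‖ ≤ √3` if `γ ≠ 0` and `≤ 2` always, for signs `g₀, g₁ = ±1`. -/
theorem norm_sign_add_sign_mul_char_le (g₀ g₁ : ℂ) (h₀ : g₀ = 1 ∨ g₀ = -1) (h₁ : g₁ = 1 ∨ g₁ = -1) (γ : ZMod 3) :
    ‖g₀ + g₁ * (ZMod.stdAddChar γ : ℂ)‖ ≤ if γ ≠ 0 then Real.sqrt 3 else 2 := by
  have hχ : ‖(ZMod.stdAddChar γ : ℂ)‖ = 1 := AffBells21.norm_stdAddChar_three γ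
  -- reduce to `‖1 + t·ω^γ‖` with `t = g₀ g₁ = ±1`
  have hfac : g₀ + g₁ * (ZMod.stdAddChar γ : ℂ) = g₀ * (1 + (g₀ * g₁) * (ZMod.stdAddChar γ : ℂ)) := by
    rcases h₀ with h | h <;> subst h <;> ring
  have hn0 : ‖g₀‖ = 1 := by rcases h₀ with h | h <;> simp [h]
  obtain ⟨t, ht⟩ : ∃ t : ZMod 2, g₀ * g₁ = (ZMod.stdAddChar t : ℂ) := by
    rcases h₀ with h | h <;> rcases h₁ with h' | h' <;> subst h <;> subst h'
    · exact ⟨0, by simp⟩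
    · exact ⟨1, by rw [stdAddChar_one_zmod_two]; ring⟩
    · exact ⟨1, by rw [stdAddChar_one_zmod_two]; ring⟩
    · exact ⟨0, by simp⟩
  rw [hfac, norm_mul, hn0, one_mul, ht]
  split_ifs with hγ
  · have h32 : (3 : ℕ).Coprime 2 := by decide
    have h := TwoModuli.norm_one_add_stdAddChar_mul_stdAddChar_le h32 hγ t
    have hcos : 2 * Real.cos (Real.pi / ((3 : ℕ) * (2 : ℕ) : ℝ)) = Real.sqrt 3 := by
      have e : (Real.pi / ((3 : ℕ) * (2 : ℕ) : ℝ)) = Real.pi / 6 := by push_cast; ring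
      rw [e, Real.cos_pi_div_six]; ring
    rw [hcos] at h
    rw [mul_comm ((ZMod.stdAddChar t : ℂ))]
    exact h
  · calc ‖(1 : ℂ) + (ZMod.stdAddChar t : ℂ) * (ZMod.stdAddChar γ : ℂ)‖
        ≤ ‖(1 : ℂ)‖ + ‖(ZMod.stdAddChar t : ℂ) * (ZMod.stdAddChar γ : ℂ)‖ := norm_add_le _ _
      _ = 2 := by
          rw [norm_mul, hχ, ZMod.stdAddChar_apply, Circle.norm_coe]
          norm_num

/-- **Coordinate product versus character**: `‖Σ_v Ψ(v) ω^{Σ_i [v_i]γ_i}‖ ≤ Π_i (γ_i ≠ 0 ? √3 : 2)`. -/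
theorem norm_sum_coordProduct_mul_char_le {Ψ : (ι → Bool) → ℂ} (hΨ : IsCoordProduct Ψ) (γ : ι → ZMod 3) :
    ‖∑ v : ι → Bool, Ψ v * (ZMod.stdAddChar (∑ i, if v i then γ i else 0) : ℂ)‖
      ≤ ∏ i, (if γ i ≠ 0 then Real.sqrt 3 else 2) := by
  obtain ⟨c, hc, h, hh, e⟩ := hΨ
  have hterm : ∀ v : ι → Bool, Ψ v * (ZMod.stdAddChar (∑ i, if v i then γ i else 0) : ℂ)
      = c * ∏ i, (fun (i : ι) (b : Bool) => h i b * (if b then (ZMod.stdAddChar (γ i) : ℂ) else 1)) i (v i) := by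
    intro v
    rw [e v, TwoModuli.stdAddChar_sum_ite, mul_assoc, ← prod_mul_distrib]
  rw [sum_congr rfl fun v _ => hterm v, ← mul_sum,
    TwoModuli.sum_bool_fun_prod (fun (i : ι) (b : Bool) => h i b * (if b then (ZMod.stdAddChar (γ i) : ℂ) else 1)),
    norm_mul]
  have hcn : ‖c‖ = 1 := by rcases hc with h | h <;> simp [h]
  rw [hcn, one_mul, norm_prod]
  refine prod_le_prod (fun i _ => norm_nonneg _) fun i _ => ?_
  simp only [Bool.false_eq_true, if_false, if_true, mul_one]
  exact norm_sign_add_sign_mul_char_le _ _ (hh i false) (hh i true) (γ i)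

end AffBells22

end Summit.QuantumAdvantage.AdviceFreeQNC0
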